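import Literature.MathematicalPhysics.QuantumManyBody.PeriodicBoseGasFourier
import Literature.MathematicalPhysics.QuantumManyBody.PeriodicBoseGasThm31
import Literature.MathematicalPhysics.QuantumManyBody.BoseGasThermodynamicLimitProofs
import Mathlib.Analysis.Calculus.ParametricIntegral
import HarnessLib

/-!
# Fourier series of periodic `N`-body wave functions on the cell `[0,L)^{3N}`

Topic `Literature/MathematicalPhysics/QuantumManyBody`, `N`-body companion of
`PeriodicBoseGasFourier.lean` (which treats one particle, `(ℝ/ℤ)³`). Written for the provefact
`Literature.MathematicalPhysics.QuantumManyBody.BoseGas.BoccatoEtAl2019Acta_firstExcitation`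
([BoccatoEtAl2019Acta, Thm. 1.1]): the min–max step of its proof (§6) needs the periodic `N`-body
Hamiltonian as a closed form with compact resolvent on `L²` of the torus `(ℝ³/Lℤ³)^N`, and the
spectral (momentum) representation of the kinetic energy is the tool for both the closability and
the compactness (Rellich) of that form (`PeriodicFormDomain.lean`).

We transport Mathlib's Fourier analysis on `UnitAddTorus (Fin N × Fin 3) = (ℝ/ℤ)^{3N}`
(`UnitAddTorus.mFourierCoeff`, the Hilbert basis `UnitAddTorus.mFourierBasis`, Parseval
`UnitAddTorus.hasSum_sq_mFourierCoeff`) to functions `Ψ : Config N → ℂ` on `(ℝ³)^N` that are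
`Lℤ³`-periodic in every particle (`IsTorusPeriodic`, the periodicity clause of `PeriodicTrialState`):
* `toUnitTorusN L X = (x_{i,k}/L mod 1)_{i,k}`, `fromUnitTorusN L t ∈ (0,L]^{3N}` (the scaled
  representative), `torusFunN L Ψ = Ψ ∘ fromUnitTorusN L` (for periodic `Ψ` the function it
  induces on the torus, `torusFunN_toUnitTorusN`), the plane waves `cellWaveN L n X = e^{2πi n·X/L}`
  and the coefficients `configFourierCoeff L Ψ n = L^{-3N} ∫_{[0,L)^{3N}} e^{-2πi n·X/L} Ψ(X) dX`,
  `n ∈ ℤ^{3N}` (`configFourierCoeff_eq_integral`);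
* **change of variables** `∫_{(ℝ/ℤ)^{3N}} G ∘ fromUnitTorusN L = L^{-3N} ∫_{[0,L)^{3N}} G`
  (`map_fromUnitTorusN`, `lintegral_fromUnitTorusN`, `integral_fromUnitTorusN`), assembled from the
  one-particle transport of `PeriodicBoseGasFourier.lean` by `Measure.pi_map_pi`;
* **Parseval** `∑ₙ ‖ĉₙ(Ψ)‖² = L^{-3N} ∫_{[0,L)^{3N}} ‖Ψ‖²` for continuous `Ψ`
  (`hasSum_sq_configFourierCoeff`, `tsum_sq_configFourierCoeff`);
* **translation rule** `ĉₙ(Ψ(· + H)) = e^{2πi n·H/L} ĉₙ(Ψ)` for periodic `Ψ`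
  (`configFourierCoeff_translate`), and from it, by differentiating in the translation
  parameter under the integral sign, the **derivative rule** `ĉₙ(∂_{i,k}Ψ) = (2πi n_{i,k}/L) ĉₙ(Ψ)`
  for `C¹` periodic `Ψ` (`configFourierCoeff_fderiv`) — no integration by parts, uniformly in
  the dimension;
* the **spectral kinetic energy** `∑ₙ (4π²|n|²/L²) ‖ĉₙ(Ψ)‖² = L^{-3N} ∫_{[0,L)^{3N}} |∇Ψ|²`
  (`tsum_sq_mul_sq_configFourierCoeff`, with `|∇Ψ|² = kineticDensity Ψ` of
  `BoseEinsteinCondensation.lean`).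

## References
* [BoccatoEtAl2019Acta] C. Boccato, C. Brennecke, S. Cenatiempo, B. Schlein, Acta Math. 222 (2019),
  (2.1) (momentum representation on the unit torus, `Λ*₊ = 2πℤ³`), §6.
* [LSSY2005] E. H. Lieb, R. Seiringer, J. P. Solovej, J. Yngvason, *The Mathematics of the Bose Gas
  and its Condensation* (2005), App. A (A.10) (the kinetic energy `∑_p p² a†_p a_p` on the torus).
-/

noncomputable section

open MeasureTheory Filter Set WithLp Complex UnitAddTorus
open scoped ENNReal NNReal Topology ComplexConjugate

namespace Literature.MathematicalPhysics.QuantumManyBody.BoseGas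

/-- As in `PeriodicBoseGasFourier.lean` and `Mathlib.Analysis.Fourier.AddCircleMulti`, the
measure on `ℝ/ℤ` is the Haar probability measure (a LOCAL instance, definitionally the one of
`PeriodicBoseGasFourier.lean`, so that the one-particle transport lemmas apply verbatim). [folklore] -/
local instance configFourier_measureSpace : MeasureSpace UnitAddCircle := ⟨AddCircle.haarAddCircle⟩

/-- The measure on `ℝ/ℤ` is a probability measure. [folklore] -/
local instance configFourier_isProbabilityMeasure : IsProbabilityMeasure (volume : Measure UnitAddCircle) :=
  inferInstanceAs (IsProbabilityMeasure AddCircle.haarAddCircle)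

/-- The measure on `(ℝ/ℤ)^D` is a probability measure. [folklore] -/
local instance configFourier_isProbabilityMeasure_pi {D : Type*} [Fintype D] :
    IsProbabilityMeasure (volume : Measure (UnitAddTorus D)) := by
  rw [volume_pi]; infer_instance

/-- The measure on `ℝ/ℤ` is translation invariant (it is the Haar measure). [folklore] -/
local instance configFourier_isAddLeftInvariant : (volume : Measure UnitAddCircle).IsAddLeftInvariant :=
  inferInstanceAs (AddCircle.haarAddCircle).IsAddLeftInvariant

/-- The measure on `(ℝ/ℤ)^D` is translation invariant (product of Haar measures). [folklore] -/
local instance configFourier_isAddLeftInvariant_pi {D : Type*} [Fintype D] :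
    (volume : Measure (UnitAddTorus D)).IsAddLeftInvariant := by
  rw [volume_pi]; infer_instance

variable {N : ℕ}

/-! ### Periodic `N`-body functions and the `3N`-torus -/

/-- `Lℤ³`-periodicity of an `N`-body function in every particle coordinate, stated on the
generators `L e_{i,k}` of the period lattice (the periodicity clause of `PeriodicTrialState`;
`IsLatticePeriodic` of `LangevinGenerator.lean` is the real-valued case). [folklore] -/
def IsTorusPeriodic (L : ℝ) {E : Type*} (Ψ : Config N → E) : Prop :=
  ∀ (X : Config N) (i : Fin N) (k : Fin 3), Ψ (X + Pi.single i (EuclideanSpace.single k L)) = Ψ X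

/-- The point `(x_{i,k}/L mod 1)_{i,k}` of the unit torus `(ℝ/ℤ)^{3N}` under a configuration
`X ∈ (ℝ³)^N` (covering map of `(ℝ³/Lℤ³)^N ≅ (ℝ/ℤ)^{3N}`). [folklore] -/
def toUnitTorusN (L : ℝ) (X : Config N) : UnitAddTorus (Fin N × Fin 3) :=
  fun p => toUnitTorus L (X p.1) p.2

/-- The representative in `(0,L]^{3N}` of a point of the unit torus `(ℝ/ℤ)^{3N}`, as a
configuration (particle by particle `fromUnitTorus`). [folklore] -/
def fromUnitTorusN (L : ℝ) (t : UnitAddTorus (Fin N × Fin 3)) : Config N :=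
  fun i => fromUnitTorus L (fun k => t (i, k))

/-- The function on `(ℝ/ℤ)^{3N}` induced by an `N`-body function and the side `L`
(`torusFunN_toUnitTorusN`: for periodic `Ψ` it is the function `Ψ` defines on the torus).
[folklore] -/
def torusFunN (L : ℝ) (Ψ : Config N → ℂ) (t : UnitAddTorus (Fin N × Fin 3)) : ℂ :=
  Ψ (fromUnitTorusN L t)

/-- The Fourier coefficient `ĉₙ(Ψ) = L^{-3N} ∫_{[0,L)^{3N}} e^{-2πi n·X/L} Ψ(X) dX`, `n ∈ ℤ^{3N}`,
of an `N`-body function on the cell of side `L` (Mathlib's `mFourierCoeff` of the induced torus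
function; `configFourierCoeff_eq_integral`). [cite: BoccatoEtAl2019Acta, (2.1)] -/
def configFourierCoeff (L : ℝ) (Ψ : Config N → ℂ) (n : Fin N × Fin 3 → ℤ) : ℂ :=
  mFourierCoeff (torusFunN L Ψ) n

section Transport

variable {L : ℝ}

/-- `fromUnitTorusN L t i = fromUnitTorus L (t(i, ·))`. [folklore] -/
theorem fromUnitTorusN_apply (L : ℝ) (t : UnitAddTorus (Fin N × Fin 3)) (i : Fin N) :
    fromUnitTorusN L t i = fromUnitTorus L (fun k => t (i, k)) := rfl

/-- `toUnitTorusN` is additive. [folklore] -/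
theorem toUnitTorusN_add (L : ℝ) (X Y : Config N) :
    toUnitTorusN L (X + Y) = toUnitTorusN L X + toUnitTorusN L Y := by
  funext p
  simp only [toUnitTorusN, toUnitTorus, Pi.add_apply, PiLp.add_apply, add_div]
  rfl

/-- `toUnitTorusN` commutes with real scalings of the numerator: `toUnitTorusN L (s • X)` has
coordinates `s x_{i,k}/L mod 1`. [folklore] -/
theorem toUnitTorusN_apply (L : ℝ) (X : Config N) (p : Fin N × Fin 3) :
    toUnitTorusN L X p = ((X p.1 p.2 / L : ℝ) : UnitAddCircle) := rfl

/-- `update`-ing one particle by a translate is translating by `Pi.single`. [folklore] -/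
theorem update_eq_add_single (Y : Config N) (i : Fin N) (v : Space) :
    Function.update Y i (Y i + v) = Y + Pi.single i v := by
  funext j
  rcases eq_or_ne j i with rfl | hj
  · simp
  · simp [hj]

/-- Periodicity in one particle extends to its lattice `Lℤ³`. [folklore] -/
theorem IsTorusPeriodic.add_single_latticeVec {E : Type*} {Ψ : Config N → E}
    (h : IsTorusPeriodic L Ψ) (Y : Config N) (i : Fin N) (m : Fin 3 → ℤ) :
    Ψ (Y + Pi.single i (latticeVec L m)) = Ψ Y := by
  have hφ : ∀ (x : Space) (k : Fin 3), (fun x => Ψ (Function.update Y i x)) (x + EuclideanSpace.single k L)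
      = (fun x => Ψ (Function.update Y i x)) x := by
    intro x k
    have hu : Function.update Y i (x + EuclideanSpace.single k L) =
        Function.update Y i x + Pi.single i (EuclideanSpace.single k L) := by
      have := update_eq_add_single (Function.update Y i x) i (EuclideanSpace.single k L)
      simpa using this
    show Ψ (Function.update Y i (x + EuclideanSpace.single k L)) = Ψ (Function.update Y i x)
    rw [hu]
    exact h _ i k
  have := periodic_latticeVec (φ := fun x => Ψ (Function.update Y i x)) hφ (Y i) m
  simp only [update_eq_add_single, Function.update_eq_self] at this
  exact this

/-- Periodicity on the generators extends to the whole lattice `(Lℤ³)^N` (`latticeVecN` of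
`BoseGasThermodynamicLimitProofs.lean`). [folklore] -/
theorem IsTorusPeriodic.add_latticeVecN {E : Type*} {Ψ : Config N → E} (h : IsTorusPeriodic L Ψ)
    (X : Config N) (m : Fin N → Fin 3 → ℤ) : Ψ (X + latticeVecN L m) = Ψ X := by
  classical
  have key : ∀ s : Finset (Fin N), Ψ (X + ∑ i ∈ s, Pi.single i (latticeVec L (m i))) = Ψ X := by
    intro s
    induction s using Finset.induction_on with
    | empty => simp
    | insert j s hj ih =>
      rw [Finset.sum_insert hj, add_comm (Pi.single j _), ← add_assoc, h.add_single_latticeVec, ih]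
  have hsum : latticeVecN L m = ∑ i, Pi.single i (latticeVec L (m i)) :=
    (Finset.univ_sum_single (latticeVecN L m)).symm
  rw [hsum]
  exact key _

/-- The scaled representative of `toUnitTorusN L X` differs from `X` by a lattice configuration.
[folklore] -/
theorem exists_fromUnitTorusN_toUnitTorusN_eq (hL : 0 < L) (X : Config N) :
    ∃ m : Fin N → Fin 3 → ℤ, fromUnitTorusN L (toUnitTorusN L X) = X + latticeVecN L m := by
  choose m hm using fun i => exists_fromUnitTorus_toUnitTorus_eq hL (X i)
  refine ⟨m, funext fun i => ?_⟩
  rw [fromUnitTorusN_apply, Pi.add_apply]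
  exact hm i

/-- For a periodic function the induced torus function recovers `Ψ`:
`torusFunN L Ψ (toUnitTorusN L X) = Ψ X`. [folklore] -/
theorem torusFunN_toUnitTorusN (hL : 0 < L) {Ψ : Config N → ℂ} (h : IsTorusPeriodic L Ψ)
    (X : Config N) : torusFunN L Ψ (toUnitTorusN L X) = Ψ X := by
  obtain ⟨m, hm⟩ := exists_fromUnitTorusN_toUnitTorusN_eq hL X
  rw [torusFunN, hm, h.add_latticeVecN]

/-- `toUnitTorusN L ∘ fromUnitTorusN L = id` (`L ≠ 0`). [folklore] -/
theorem toUnitTorusN_fromUnitTorusN (hL : L ≠ 0) (t : UnitAddTorus (Fin N × Fin 3)) :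
    toUnitTorusN L (fromUnitTorusN L t) = t := by
  funext p
  have := congrFun (toUnitTorus_fromUnitTorus hL (fun k => t (p.1, k))) p.2
  simpa [toUnitTorusN, fromUnitTorusN_apply] using this

/-- Translating a periodic function translates its torus function:
`torusFunN L (Ψ(· + H)) = torusFunN L Ψ (· + toUnitTorusN L H)`. [folklore] -/
theorem torusFunN_translate (hL : 0 < L) {Ψ : Config N → ℂ} (h : IsTorusPeriodic L Ψ)
    (H : Config N) (t : UnitAddTorus (Fin N × Fin 3)) :
    torusFunN L (fun X => Ψ (X + H)) t = torusFunN L Ψ (t + toUnitTorusN L H) := by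
  simp only [torusFunN]
  rw [← torusFunN_toUnitTorusN hL h (fromUnitTorusN L t + H), toUnitTorusN_add,
    toUnitTorusN_fromUnitTorusN hL.ne']
  rfl

/-- `fromUnitTorusN L` is measurable. [folklore] -/
theorem measurable_fromUnitTorusN (L : ℝ) : Measurable (fromUnitTorusN (N := N) L) :=
  measurable_pi_lambda _ fun i =>
    (measurable_fromUnitTorus L).comp (measurable_pi_lambda _ fun k => measurable_pi_apply (i, k))

/-- `toUnitTorusN L` is measurable. [folklore] -/
theorem measurable_toUnitTorusN (L : ℝ) : Measurable (toUnitTorusN (N := N) L) := by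
  refine measurable_pi_lambda _ fun p => ?_
  have h1 : Measurable fun X : Config N => (X p.1) p.2 :=
    ((PiLp.continuous_apply 2 (fun _ : Fin 3 => ℝ) p.2).comp (continuous_apply p.1)).measurable
  exact AddCircle.measurable_mk'.comp (h1.div_const L)

/-- The closed box `[0,L]^{3N}` is compact. [folklore] -/
theorem isCompact_closedBoxN (N : ℕ) (L : ℝ) :
    IsCompact {X : Config N | ∀ i, X i ∈ (toLp 2 '' Set.univ.pi fun _ : Fin 3 => Icc (0 : ℝ) L : Set Space)} := by
  have : {X : Config N | ∀ i, X i ∈ (toLp 2 '' Set.univ.pi fun _ : Fin 3 => Icc (0 : ℝ) L : Set Space)}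
      = Set.univ.pi fun _ : Fin N => (toLp 2 '' Set.univ.pi fun _ : Fin 3 => Icc (0 : ℝ) L : Set Space) := by
    ext X; simp
  rw [this]
  exact isCompact_univ_pi fun _ => isCompact_closedBox L

/-- The values of `fromUnitTorusN L` lie in the closed box `[0,L]^{3N}` (`0 < L`). [folklore] -/
theorem fromUnitTorusN_mem_closedBoxN (hL : 0 < L) (t : UnitAddTorus (Fin N × Fin 3)) :
    fromUnitTorusN L t ∈ {X : Config N | ∀ i, X i ∈ (toLp 2 '' Set.univ.pi fun _ : Fin 3 => Icc (0 : ℝ) L : Set Space)} :=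
  fun _ => fromUnitTorus_mem_closedBox hL _

/-- The cell `[0,L)^{3N}` lies in the closed box `[0,L]^{3N}`. [folklore] -/
theorem cellN_subset_closedBoxN (N : ℕ) (L : ℝ) :
    cellN N L ⊆ {X : Config N | ∀ i, X i ∈ (toLp 2 '' Set.univ.pi fun _ : Fin 3 => Icc (0 : ℝ) L : Set Space)} :=
  fun _ hX i => cell_subset_closedBox L (hX i)

/-- A continuous function is bounded on the range of `fromUnitTorusN L`. [folklore] -/
theorem exists_bound_torusFunN (hL : 0 < L) {E : Type*} [SeminormedAddCommGroup E]
    {Ψ : Config N → E} (hΨ : Continuous Ψ) : ∃ C, ∀ t, ‖Ψ (fromUnitTorusN L t)‖ ≤ C := by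
  obtain ⟨C, hC⟩ := (isCompact_closedBoxN N L).exists_bound_of_continuousOn hΨ.continuousOn
  exact ⟨C, fun t => hC _ (fromUnitTorusN_mem_closedBoxN hL t)⟩

/-- The induced torus function of a continuous function is in `L²` of the torus. [folklore] -/
theorem memLp_torusFunN (hL : 0 < L) {Ψ : Config N → ℂ} (hΨ : Continuous Ψ) :
    MemLp (torusFunN L Ψ) 2 volume := by
  obtain ⟨C, hC⟩ := exists_bound_torusFunN hL hΨ
  exact MemLp.of_bound ((hΨ.measurable.comp (measurable_fromUnitTorusN L)).aestronglyMeasurable) C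
    (Eventually.of_forall hC)

/-- The induced torus function of a continuous function is integrable. [folklore] -/
theorem integrable_torusFunN (hL : 0 < L) {Ψ : Config N → ℂ} (hΨ : Continuous Ψ) :
    Integrable (torusFunN L Ψ) volume :=
  (memLp_torusFunN hL hΨ).integrable one_le_two

/-! ### Change of variables: the torus measure in the cell picture -/

/-- The one-particle transport as an identity of measures:
`(fromUnitTorus L)_* dt = L⁻³ dx|_{[0,L)³}`. [folklore] -/
theorem map_fromUnitTorus (hL : 0 < L) :
    Measure.map (fromUnitTorus L) volume = (ENNReal.ofReal L ^ 3)⁻¹ • volume.restrict (cell L) := by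
  ext s hs
  rw [Measure.map_apply (measurable_fromUnitTorus L) hs, Measure.smul_apply, smul_eq_mul,
    ← lintegral_indicator_one hs, ← lintegral_indicator_one ((measurable_fromUnitTorus L) hs)]
  have h := lintegral_fromUnitTorus hL (measurable_one.indicator hs : Measurable (s.indicator (1 : Space → ℝ≥0∞)))
  have hind : ∀ t, (fromUnitTorus L ⁻¹' s).indicator (1 : UnitAddTorus (Fin 3) → ℝ≥0∞) t =
      s.indicator 1 (fromUnitTorus L t) := fun t => by
    simp only [Set.indicator, Set.mem_preimage, Pi.one_apply]
    rfl
  simp_rw [hind]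
  exact h

/-- Uncurrying `((ℝ/ℤ)³)^N → (ℝ/ℤ)^{3N}` preserves the product Haar measures. [folklore] -/
theorem measurePreserving_uncurry_torus :
    MeasurePreserving (fun x : Fin N → UnitAddTorus (Fin 3) => fun p : Fin N × Fin 3 => x p.1 p.2)
      volume volume := by
  have hmeas : Measurable fun x : Fin N → UnitAddTorus (Fin 3) => fun p : Fin N × Fin 3 => x p.1 p.2 :=
    measurable_pi_lambda _ fun p => (measurable_pi_apply p.2).comp (measurable_pi_apply p.1)
  refine ⟨hmeas, ?_⟩
  symm
  refine Measure.pi_eq fun s hs => ?_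
  rw [Measure.map_apply hmeas (MeasurableSet.univ_pi hs)]
  have hpre : (fun x : Fin N → UnitAddTorus (Fin 3) => fun p : Fin N × Fin 3 => x p.1 p.2) ⁻¹'
      Set.univ.pi s = Set.univ.pi fun i => Set.univ.pi fun k => s (i, k) := by
    ext x; simp
  rw [hpre, volume_pi, Measure.pi_pi]
  simp_rw [volume_pi, Measure.pi_pi]
  rw [← Finset.univ_product_univ, Finset.prod_product]

/-- Currying `(ℝ/ℤ)^{3N} → ((ℝ/ℤ)³)^N` preserves the product Haar measures. [folklore] -/
theorem measurePreserving_curry_torus :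
    MeasurePreserving (fun t : UnitAddTorus (Fin N × Fin 3) => fun (i : Fin N) (k : Fin 3) => t (i, k))
      volume volume := by
  have h := (measurePreserving_uncurry_torus (N := N)).symm
    (MeasurableEquiv.curry (Fin N) (Fin 3) UnitAddCircle).symm
  rw [MeasurableEquiv.symm_symm, MeasurableEquiv.coe_curry] at h
  exact h

/-- Scalars come out of finite product measures: `⨂ᵢ (c • νᵢ) = c^N • ⨂ᵢ νᵢ`. [folklore] -/
theorem pi_const_smul {ι : Type*} [Fintype ι] {α : ι → Type*} [∀ i, MeasurableSpace (α i)]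
    (ν : ∀ i, Measure (α i)) [∀ i, SigmaFinite (ν i)] (c : ℝ≥0∞) (hc : c ≠ ⊤) :
    Measure.pi (fun i => c • ν i) = c ^ Fintype.card ι • Measure.pi ν := by
  lift c to ℝ≥0 using hc
  have : ∀ i, SigmaFinite ((c : ℝ≥0∞) • ν i) := fun i => by
    rw [← ENNReal.smul_def]
    infer_instance
  refine Measure.pi_eq fun s _ => ?_
  rw [Measure.smul_apply, smul_eq_mul, Measure.pi_pi]
  simp only [Measure.smul_apply, smul_eq_mul]
  rw [Finset.prod_mul_distrib, Finset.prod_const, Finset.card_univ]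

/-- **The `N`-body transport as an identity of measures**:
`(fromUnitTorusN L)_* dt = L^{-3N} dX|_{[0,L)^{3N}}`. [folklore] -/
theorem map_fromUnitTorusN (hL : 0 < L) :
    Measure.map (fromUnitTorusN (N := N) L) volume =
      ((ENNReal.ofReal L ^ 3)⁻¹) ^ N • volume.restrict (cellN N L) := by
  set g : (Fin N → UnitAddTorus (Fin 3)) → Config N := fun x i => fromUnitTorus L (x i) with hg
  have hgm : Measurable g := measurable_pi_lambda _ fun i => (measurable_fromUnitTorus L).comp (measurable_pi_apply i)
  have hcomp : fromUnitTorusN (N := N) L =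
      g ∘ fun t : UnitAddTorus (Fin N × Fin 3) => fun (i : Fin N) (k : Fin 3) => t (i, k) := rfl
  rw [hcomp, ← Measure.map_map hgm measurePreserving_curry_torus.measurable,
    measurePreserving_curry_torus.map_eq]
  have hpi : Measure.map g (volume : Measure (Fin N → UnitAddTorus (Fin 3))) =
      Measure.pi fun _ : Fin N => Measure.map (fromUnitTorus L) volume := by
    rw [volume_pi, hg]
    exact Measure.pi_map_pi fun _ => (measurable_fromUnitTorus L).aemeasurable
  rw [hpi]
  simp only [map_fromUnitTorus hL]
  rw [pi_const_smul _ _ (ENNReal.inv_ne_top.2 (pow_ne_zero _ ((ENNReal.ofReal_pos.2 hL).ne'))),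
    Fintype.card_fin, ← volume_restrict_cellN]

/-- **Integration over the torus in the cell picture** (`ℝ≥0∞` version):
`∫_{(ℝ/ℤ)^{3N}} G(fromUnitTorusN L t) dt = L^{-3N} ∫_{[0,L)^{3N}} G`. [folklore] -/
theorem lintegral_fromUnitTorusN (hL : 0 < L) {G : Config N → ℝ≥0∞} (hG : Measurable G) :
    ∫⁻ t, G (fromUnitTorusN L t) = ((ENNReal.ofReal L ^ 3)⁻¹) ^ N * ∫⁻ X in cellN N L, G X := by
  rw [← lintegral_map hG (measurable_fromUnitTorusN L), map_fromUnitTorusN hL,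
    lintegral_smul_measure, smul_eq_mul]

/-- **Integration over the torus in the cell picture** (Bochner version):
`∫_{(ℝ/ℤ)^{3N}} G(fromUnitTorusN L t) dt = L^{-3N} ∫_{[0,L)^{3N}} G` for `G` a.e.-strongly measurable
on the cell. [folklore] -/
theorem integral_fromUnitTorusN (hL : 0 < L) {E : Type*} [NormedAddCommGroup E] [NormedSpace ℝ E]
    {G : Config N → E} (hG : AEStronglyMeasurable G (volume.restrict (cellN N L))) :
    ∫ t, G (fromUnitTorusN L t) = ((((L ^ 3)⁻¹) ^ N : ℝ)) • ∫ X in cellN N L, G X := by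
  have hG' : AEStronglyMeasurable G (Measure.map (fromUnitTorusN (N := N) L) volume) := by
    rw [map_fromUnitTorusN hL]
    exact hG.smul_measure _
  rw [← integral_map (measurable_fromUnitTorusN L).aemeasurable hG', map_fromUnitTorusN hL,
    integral_smul_measure]
  congr 1
  rw [ENNReal.toReal_pow, ENNReal.toReal_inv, ENNReal.toReal_pow, ENNReal.toReal_ofReal hL.le]

end Transport

/-! ### Parseval -/

section Parseval

variable {L : ℝ}

/-- `ofReal (L^{-3N}) = (ofReal L ^ 3)⁻¹ ^ N` in `ℝ≥0∞`. [folklore] -/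
theorem ofReal_inv_pow_three_pow (hL : 0 < L) (N : ℕ) :
    ENNReal.ofReal (((L ^ 3)⁻¹) ^ N) = ((ENNReal.ofReal L ^ 3)⁻¹) ^ N := by
  rw [ENNReal.ofReal_pow (by positivity), ENNReal.ofReal_inv_of_pos (by positivity),
    ENNReal.ofReal_pow hL.le]

/-- A continuous function is square integrable on the cell `[0,L)^{3N}`. [folklore] -/
theorem integrableOn_sq_cellN (L : ℝ) {Ψ : Config N → ℂ} (hΨ : Continuous Ψ) :
    IntegrableOn (fun X : Config N => ‖Ψ X‖ ^ 2) (cellN N L) volume :=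
  ((hΨ.norm.pow 2).continuousOn.integrableOn_compact (isCompact_closedBoxN N L)).mono_set
    (cellN_subset_closedBoxN N L)

/-- The Fourier coefficients of the `L²` class of the torus function are the `configFourierCoeff`.
[folklore] -/
theorem mFourierCoeff_toLp_torusFunN (hL : 0 < L) {Ψ : Config N → ℂ} (hΨ : Continuous Ψ)
    (n : Fin N × Fin 3 → ℤ) :
    mFourierCoeff ((memLp_torusFunN hL hΨ).toLp _ : UnitAddTorus (Fin N × Fin 3) → ℂ) n =
      configFourierCoeff L Ψ n :=
  integral_congr_ae ((memLp_torusFunN hL hΨ).coeFn_toLp.mono fun t ht => by simp only [ht])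

/-- **Parseval on the cell `[0,L)^{3N}`.** For continuous `Ψ`,
`∑ₙ ‖ĉₙ(Ψ)‖² = L^{-3N} ∫_{[0,L)^{3N}} ‖Ψ‖²` (Mathlib's Parseval identity for `L²((ℝ/ℤ)^{3N})`
transported). [folklore] -/
theorem hasSum_sq_configFourierCoeff (hL : 0 < L) {Ψ : Config N → ℂ} (hΨ : Continuous Ψ) :
    HasSum (fun n => ‖configFourierCoeff L Ψ n‖ ^ 2)
      (((L ^ 3)⁻¹) ^ N * ∫ X in cellN N L, ‖Ψ X‖ ^ 2) := by
  have hf := memLp_torusFunN hL hΨ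
  have hP := UnitAddTorus.hasSum_sq_mFourierCoeff (hf.toLp _)
  have hnorm : ∫ t, ‖(hf.toLp _ : UnitAddTorus (Fin N × Fin 3) → ℂ) t‖ ^ 2 =
      ∫ t, ‖torusFunN L Ψ t‖ ^ 2 :=
    integral_congr_ae (hf.coeFn_toLp.mono fun t ht => by simp only [ht])
  simp only [mFourierCoeff_toLp_torusFunN hL hΨ, hnorm] at hP
  have htr := integral_fromUnitTorusN hL (G := fun X : Config N => ‖Ψ X‖ ^ 2)
    (hΨ.norm.pow 2).aestronglyMeasurable
  simp only [smul_eq_mul] at htr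
  unfold torusFunN at hP
  rwa [htr] at hP

/-- Parseval on the cell, `ℝ≥0∞` form: `∑ₙ ‖ĉₙ(Ψ)‖₊² = L^{-3N} ∫⁻_{[0,L)^{3N}} ‖Ψ‖₊²`. [folklore] -/
theorem tsum_sq_configFourierCoeff (hL : 0 < L) {Ψ : Config N → ℂ} (hΨ : Continuous Ψ) :
    ∑' n, (‖configFourierCoeff L Ψ n‖₊ : ℝ≥0∞) ^ 2 =
      ((ENNReal.ofReal L ^ 3)⁻¹) ^ N * ∫⁻ X in cellN N L, (‖Ψ X‖₊ : ℝ≥0∞) ^ 2 := by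
  have h := hasSum_sq_configFourierCoeff hL hΨ
  have hint := integrableOn_sq_cellN L hΨ
  simp only [coe_nnnorm_sq_eq_ofReal]
  rw [← ENNReal.ofReal_tsum_of_nonneg (fun n => by positivity) h.summable, h.tsum_eq,
    ENNReal.ofReal_mul (by positivity), ofReal_inv_pow_three_pow hL,
    ofReal_integral_eq_lintegral_ofReal hint (Eventually.of_forall fun x => by positivity)]

/-- Each coefficient is bounded by the `L²` norm: `‖ĉₙ(Ψ)‖² ≤ L^{-3N} ∫ ‖Ψ‖²`. [folklore] -/
theorem sq_configFourierCoeff_le (hL : 0 < L) {Ψ : Config N → ℂ} (hΨ : Continuous Ψ)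
    (n : Fin N × Fin 3 → ℤ) :
    (‖configFourierCoeff L Ψ n‖₊ : ℝ≥0∞) ^ 2 ≤
      ((ENNReal.ofReal L ^ 3)⁻¹) ^ N * ∫⁻ X in cellN N L, (‖Ψ X‖₊ : ℝ≥0∞) ^ 2 := by
  rw [← tsum_sq_configFourierCoeff hL hΨ]
  exact ENNReal.le_tsum n

end Parseval

/-! ### Translations and the derivative rule -/

section Derivative

variable {L : ℝ}

/-- The monomials are characters: `e_n(x + y) = e_n(x) e_n(y)`. [folklore] -/
theorem mFourier_apply_add {D : Type*} [Fintype D] (n : D → ℤ) (x y : UnitAddTorus D) :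
    mFourier n (x + y) = mFourier n x * mFourier n y := by
  simp only [mFourier, ContinuousMap.coe_mk, Pi.add_apply, ← Finset.prod_mul_distrib]
  refine Finset.prod_congr rfl fun i _ => ?_
  rw [fourier_apply, fourier_apply, fourier_apply, smul_add, AddCircle.toCircle_add, Circle.coe_mul]

/-- `e_{-n}(-a) = e_n(a)`. [folklore] -/
theorem mFourier_neg_apply_neg {D : Type*} [Fintype D] (n : D → ℤ) (a : UnitAddTorus D) :
    mFourier (-n) (-a) = mFourier n a := by
  simp only [mFourier, ContinuousMap.coe_mk, Pi.neg_apply, fourier_apply, neg_smul, smul_neg,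
    neg_neg]

/-- **Fourier coefficients of a translate**: `ĉₙ(f(· + a)) = e_n(a) ĉₙ(f)` on the torus
(translation invariance of the Haar measure). [folklore] -/
theorem mFourierCoeff_comp_add_right {D : Type*} [Fintype D] (f : UnitAddTorus D → ℂ)
    (a : UnitAddTorus D) (n : D → ℤ) :
    mFourierCoeff (fun t => f (t + a)) n = mFourier n a * mFourierCoeff f n := by
  unfold mFourierCoeff
  have h := integral_add_left_eq_self (μ := (volume : Measure (UnitAddTorus D)))
    (fun t => mFourier (-n) (t - a) • f t) a
  have h' : (fun t => mFourier (-n) (a + t - a) • f (a + t)) = fun t => mFourier (-n) t • f (t + a) := by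
    funext t; rw [add_sub_cancel_left, add_comm]
  rw [h'] at h
  rw [h]
  have hpt : ∀ t, mFourier (-n) (t - a) • f t = mFourier n a * (mFourier (-n) t • f t) := fun t => by
    rw [sub_eq_add_neg, mFourier_apply_add, mFourier_neg_apply_neg, smul_eq_mul, smul_eq_mul]
    ring
  simp_rw [hpt]
  exact integral_const_mul _ _

/-- **Fourier coefficients of a translated periodic function**:
`ĉₙ(Ψ(· + H)) = e_n(H/L mod 1) ĉₙ(Ψ)`. [folklore] -/
theorem configFourierCoeff_translate (hL : 0 < L) {Ψ : Config N → ℂ} (h : IsTorusPeriodic L Ψ)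
    (H : Config N) (n : Fin N × Fin 3 → ℤ) :
    configFourierCoeff L (fun X => Ψ (X + H)) n =
      mFourier n (toUnitTorusN L H) * configFourierCoeff L Ψ n := by
  unfold configFourierCoeff
  rw [show torusFunN L (fun X => Ψ (X + H)) = fun t => torusFunN L Ψ (t + toUnitTorusN L H) from
    funext (torusFunN_translate hL h H)]
  exact mFourierCoeff_comp_add_right _ _ _

/-- The character at the translation `s e_{i,k}`: `e_n(s e_{i,k}/L mod 1) = exp(2πi n_{i,k} s/L)`.
[folklore] -/
theorem mFourier_toUnitTorusN_smul_single (L : ℝ) (n : Fin N × Fin 3 → ℤ) (i : Fin N) (k : Fin 3)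
    (s : ℝ) :
    mFourier n (toUnitTorusN L (s • (Pi.single i (EuclideanSpace.single k (1 : ℝ)) : Config N))) =
      Complex.exp (2 * Real.pi * I * (n (i, k)) * (s / L)) := by
  classical
  simp only [mFourier, ContinuousMap.coe_mk]
  rw [Finset.prod_eq_single (i, k)]
  · rw [toUnitTorusN_apply, fourier_coe_apply]
    have hval : (s • (Pi.single i (EuclideanSpace.single k (1 : ℝ)) : Config N)) i k = s := by
      simp [Pi.smul_apply, PiLp.smul_apply]
    rw [show ((i, k) : Fin N × Fin 3).1 = i from rfl, show ((i, k) : Fin N × Fin 3).2 = k from rfl, hval]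
    congr 1
    push_cast
    ring
  · intro p _ hp
    rw [toUnitTorusN_apply]
    have : (s • (Pi.single i (EuclideanSpace.single k (1 : ℝ)) : Config N)) p.1 p.2 = 0 := by
      simp only [Pi.smul_apply, PiLp.smul_apply, smul_eq_mul]
      rcases eq_or_ne p.1 i with h1 | h1
      · have h2 : p.2 ≠ k := fun h2 => hp (Prod.ext h1 h2)
        rw [h1, Pi.single_eq_same, PiLp.single_apply, if_neg h2, mul_zero]
      · rw [Pi.single_eq_of_ne h1]
        simp
    rw [this, zero_div, fourier_apply]
    simp
  · intro h; exact absurd (Finset.mem_univ _) h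

/-- **The derivative rule** `ĉₙ(∂_{i,k}Ψ) = (2πi n_{i,k}/L) ĉₙ(Ψ)` for a `C¹` periodic `N`-body
function: differentiate `s ↦ ĉₙ(Ψ(· + s e_{i,k})) = exp(2πi n_{i,k}s/L) ĉₙ(Ψ)`
(`configFourierCoeff_translate`) at `s = 0`, under the integral sign on the left. [folklore] -/
theorem configFourierCoeff_fderiv (hL : 0 < L) {Ψ : Config N → ℂ} (hΨ : ContDiff ℝ 1 Ψ)
    (hper : IsTorusPeriodic L Ψ) (n : Fin N × Fin 3 → ℤ) (i : Fin N) (k : Fin 3) :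
    configFourierCoeff L (fun X => fderiv ℝ Ψ X (Pi.single i (EuclideanSpace.single k 1))) n =
      (2 * Real.pi * I * (n (i, k)) / L) * configFourierCoeff L Ψ n := by
  set e : Config N := Pi.single i (EuclideanSpace.single k 1) with he
  set c : ℂ := configFourierCoeff L Ψ n with hc
  have hcont : Continuous Ψ := hΨ.continuous
  have hdiff : Differentiable ℝ Ψ := hΨ.differentiable one_ne_zero
  have hfd : Continuous (fderiv ℝ Ψ) := hΨ.continuous_fderiv one_ne_zero
  have hfde : Continuous fun Y => fderiv ℝ Ψ Y e := hfd.clm_apply continuous_const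
  -- the explicit side
  have hG : ∀ s : ℝ, configFourierCoeff L (fun X => Ψ (X + s • e)) n =
      Complex.exp (2 * Real.pi * I * (n (i, k)) * (s / L)) * c := fun s => by
    rw [configFourierCoeff_translate hL hper, he, mFourier_toUnitTorusN_smul_single]
  have hD1 : HasDerivAt (fun s : ℝ => Complex.exp (2 * Real.pi * I * (n (i, k)) * (s / L)) * c)
      ((2 * Real.pi * I * (n (i, k)) / L) * c) 0 := by
    have h1 : HasDerivAt (fun s : ℝ => 2 * Real.pi * I * (n (i, k)) * ((s : ℂ) / L))
        (2 * Real.pi * I * (n (i, k)) * (1 / L)) 0 := by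
      have h0 : HasDerivAt (fun s : ℝ => ((s : ℂ) / L)) (1 / L) 0 := by
        simpa using ((hasDerivAt_id (0 : ℝ)).ofReal_comp).div_const (L : ℂ)
      exact h0.const_mul _
    have h2 := (h1.cexp).mul_const c
    simp only [ofReal_zero, zero_div, mul_zero, Complex.exp_zero, one_mul] at h2
    exact h2.congr_deriv (by ring)
  -- the integral side: differentiation under the integral sign
  set F : ℝ → UnitAddTorus (Fin N × Fin 3) → ℂ :=
    fun s t => mFourier (-n) t * Ψ (fromUnitTorusN L t + s • e) with hF
  set F' : ℝ → UnitAddTorus (Fin N × Fin 3) → ℂ :=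
    fun s t => mFourier (-n) t * fderiv ℝ Ψ (fromUnitTorusN L t + s • e) e with hF'
  have hFG : ∀ s, configFourierCoeff L (fun X => Ψ (X + s • e)) n = ∫ t, F s t := fun s => rfl
  -- a uniform bound for the derivative near the closed box
  set K : Set (Config N) := (fun q : Config N × ℝ => q.1 + q.2 • e) ''
    ({X : Config N | ∀ j, X j ∈ (toLp 2 '' Set.univ.pi fun _ : Fin 3 => Icc (0 : ℝ) L : Set Space)} ×ˢ
      Icc (-1 : ℝ) 1) with hK
  have hKc : IsCompact K :=
    ((isCompact_closedBoxN N L).prod isCompact_Icc).image (by fun_prop)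
  obtain ⟨C, hC⟩ := hKc.exists_bound_of_continuousOn hfde.continuousOn
  have hmemK : ∀ (t : UnitAddTorus (Fin N × Fin 3)) (s : ℝ), s ∈ Metric.ball (0 : ℝ) 1 →
      fromUnitTorusN L t + s • e ∈ K := fun t s hs => by
    rw [Metric.mem_ball, dist_zero_right, Real.norm_eq_abs, abs_lt] at hs
    rw [hK, Set.mem_image]
    exact ⟨(fromUnitTorusN L t, s), Set.mk_mem_prod (fromUnitTorusN_mem_closedBoxN hL t) ⟨hs.1.le, hs.2.le⟩, rfl⟩
  have hmeasF : ∀ s, AEStronglyMeasurable (F s) volume := fun s =>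
    ((mFourier (-n)).continuous.aestronglyMeasurable).mul
      ((hcont.measurable.comp ((measurable_fromUnitTorusN L).add_const _)).aestronglyMeasurable)
  have hmeasF' : ∀ s, AEStronglyMeasurable (F' s) volume := fun s =>
    ((mFourier (-n)).continuous.aestronglyMeasurable).mul
      ((hfde.measurable.comp ((measurable_fromUnitTorusN L).add_const _)).aestronglyMeasurable)
  have hnorm1 : ∀ t : UnitAddTorus (Fin N × Fin 3), ‖mFourier (-n) t‖ ≤ 1 := fun t =>
    ((mFourier (-n)).norm_coe_le_norm t).trans mFourier_norm.le
  have hint0 : Integrable (F 0) volume := by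
    have hc0 : Continuous fun X : Config N => Ψ (X + (0 : ℝ) • e) := by fun_prop
    exact (integrable_torusFunN hL hc0).bdd_mul ((mFourier (-n)).continuous.aestronglyMeasurable)
      (Eventually.of_forall hnorm1)
  have hD2 := (hasDerivAt_integral_of_dominated_loc_of_deriv_le (μ := volume) (F := F) (F' := F')
    (x₀ := (0 : ℝ)) (bound := fun _ => C) (Metric.ball_mem_nhds (0 : ℝ) zero_lt_one)
    (Eventually.of_forall hmeasF) hint0 (hmeasF' 0)
    (Eventually.of_forall fun t s hs => ?_) (integrable_const C)
    (Eventually.of_forall fun t s _ => ?_)).2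
  rotate_left
  · -- the bound
    calc ‖F' s t‖ = ‖mFourier (-n) t‖ * ‖fderiv ℝ Ψ (fromUnitTorusN L t + s • e) e‖ := norm_mul _ _
      _ ≤ 1 * C := by
          gcongr
          · exact hnorm1 t
          · exact hC _ (hmemK t s hs)
      _ = C := one_mul C
  · -- the pointwise derivative
    have hpath : HasDerivAt (fun s : ℝ => fromUnitTorusN L t + s • e) e s := by
      simpa using ((hasDerivAt_id s).smul_const e).const_add (fromUnitTorusN L t)
    have := ((hdiff (fromUnitTorusN L t + s • e)).hasFDerivAt.comp_hasDerivAt s hpath).const_mul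
      (mFourier (-n) t)
    exact this
  -- compare the two derivatives at `0`
  have hD2' : HasDerivAt (fun s : ℝ => Complex.exp (2 * Real.pi * I * (n (i, k)) * (s / L)) * c)
      (∫ t, F' 0 t) 0 := by
    exact hD2.congr_of_eventuallyEq (Eventually.of_forall fun s => (hG s).symm.trans (hFG s))
  have hval : ∫ t, F' 0 t = configFourierCoeff L (fun X => fderiv ℝ Ψ X e) n := by
    simp only [hF', zero_smul, add_zero]
    rfl
  rw [← hval]
  exact hD2'.unique hD1

/-- Partial derivatives of a `C¹` periodic function are continuous. [folklore] -/
theorem continuous_fderiv_config_single {Ψ : Config N → ℂ} (hΨ : ContDiff ℝ 1 Ψ) (i : Fin N) (k : Fin 3) :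
    Continuous fun X => fderiv ℝ Ψ X (Pi.single i (EuclideanSpace.single k 1)) :=
  (hΨ.continuous_fderiv one_ne_zero).clm_apply continuous_const

/-- `‖ĉₙ(∂_{i,k}Ψ)‖₊² = (2π n_{i,k}/L)² ‖ĉₙ(Ψ)‖₊²`. [folklore] -/
theorem nnnorm_sq_configFourierCoeff_fderiv (hL : 0 < L) {Ψ : Config N → ℂ} (hΨ : ContDiff ℝ 1 Ψ)
    (hper : IsTorusPeriodic L Ψ) (n : Fin N × Fin 3 → ℤ) (i : Fin N) (k : Fin 3) :
    (‖configFourierCoeff L (fun X => fderiv ℝ Ψ X (Pi.single i (EuclideanSpace.single k 1))) n‖₊ : ℝ≥0∞) ^ 2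
      = ENNReal.ofReal ((2 * Real.pi * (n (i, k)) / L) ^ 2) * (‖configFourierCoeff L Ψ n‖₊ : ℝ≥0∞) ^ 2 := by
  rw [configFourierCoeff_fderiv hL hΨ hper, coe_nnnorm_sq_eq_ofReal, coe_nnnorm_sq_eq_ofReal,
    norm_mul, mul_pow, ENNReal.ofReal_mul (by positivity)]
  congr 2
  have : (2 * Real.pi * I * (n (i, k)) / L : ℂ) = ((2 * Real.pi * (n (i, k)) / L : ℝ) : ℂ) * I := by
    push_cast; ring
  rw [this, norm_mul, Complex.norm_I, mul_one, Complex.norm_real, Real.norm_eq_abs, sq_abs]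

/-- **The kinetic energy in momentum space.** For a `C¹` periodic `N`-body function,
`∑ₙ (4π²|n|²/L²) ‖ĉₙ(Ψ)‖² = L^{-3N} ∫_{[0,L)^{3N}} |∇Ψ|²` (`|∇Ψ|² = kineticDensity Ψ`), i.e.
`⟨Ψ, -ΔΨ⟩ = ∑_p p² |Ψ̂(p)|²`, `p ∈ (2π/L)ℤ^{3N}`. [cite: LSSY2005, App. A (A.10)] -/
theorem tsum_sq_mul_sq_configFourierCoeff (hL : 0 < L) {Ψ : Config N → ℂ} (hΨ : ContDiff ℝ 1 Ψ)
    (hper : IsTorusPeriodic L Ψ) :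
    ∑' n : Fin N × Fin 3 → ℤ, ENNReal.ofReal (∑ p, (2 * Real.pi * (n p) / L) ^ 2) *
        (‖configFourierCoeff L Ψ n‖₊ : ℝ≥0∞) ^ 2 =
      ((ENNReal.ofReal L ^ 3)⁻¹) ^ N * ∫⁻ X in cellN N L, kineticDensity Ψ X := by
  have hkin : ∀ X, kineticDensity Ψ X = ∑ p : Fin N × Fin 3,
      (‖fderiv ℝ Ψ X (Pi.single p.1 (EuclideanSpace.single p.2 1))‖₊ : ℝ≥0∞) ^ 2 := fun X => by
    rw [kineticDensity, Fintype.sum_prod_type]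
  simp_rw [hkin]
  rw [lintegral_finsetSum _ fun p _ =>
    ((continuous_fderiv_config_single hΨ p.1 p.2).measurable.nnnorm.coe_nnreal_ennreal.pow_const 2),
    Finset.mul_sum]
  simp_rw [← tsum_sq_configFourierCoeff hL (continuous_fderiv_config_single hΨ _ _),
    nnnorm_sq_configFourierCoeff_fderiv hL hΨ hper]
  rw [← Summable.tsum_finsetSum (fun _ _ => ENNReal.summable)]
  refine tsum_congr fun n => ?_
  rw [ENNReal.ofReal_sum_of_nonneg (fun p _ => by positivity), Finset.sum_mul]

end Derivative

/-! ### The coefficients as cell integrals -/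

section CellIntegral

variable {L : ℝ}

/-- The `N`-body plane wave `e_n(X) = e^{2πi n·X/L} = ∏_{i,k} e^{2πi n_{i,k} x_{i,k}/L}`, `n ∈ ℤ^{3N}`,
as Mathlib's monomial `mFourier n` at `X/L mod ℤ^{3N}`. [cite: BoccatoEtAl2019Acta, (2.1)] -/
def cellWaveN (L : ℝ) (n : Fin N × Fin 3 → ℤ) (X : Config N) : ℂ :=
  mFourier n (toUnitTorusN L X)

/-- `e_n(X) = exp(2πi (∑_{i,k} n_{i,k} x_{i,k})/L)`. [folklore] -/
theorem cellWaveN_apply (L : ℝ) (n : Fin N × Fin 3 → ℤ) (X : Config N) :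
    cellWaveN L n X = Complex.exp (2 * Real.pi * I * (∑ p, (n p : ℝ) * X p.1 p.2) / L) := by
  unfold cellWaveN UnitAddTorus.mFourier
  simp only [ContinuousMap.coe_mk, toUnitTorusN_apply, fourier_coe_apply]
  rw [← Complex.exp_sum]
  congr 1
  push_cast
  rw [mul_div_assoc, Finset.sum_div, Finset.mul_sum]
  refine Finset.sum_congr rfl fun p _ => ?_
  ring

/-- `|e_n(X)| = 1`. [folklore] -/
theorem norm_cellWaveN (L : ℝ) (n : Fin N × Fin 3 → ℤ) (X : Config N) : ‖cellWaveN L n X‖ = 1 := by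
  rw [cellWaveN_apply, Complex.norm_exp]
  have : (2 * Real.pi * I * ((∑ p, (n p : ℝ) * X p.1 p.2 : ℝ) : ℂ) / L : ℂ) =
      ((2 * Real.pi * (∑ p, (n p : ℝ) * X p.1 p.2) / L : ℝ) : ℂ) * I := by
    push_cast; ring
  rw [this, Complex.mul_re, Complex.I_re, Complex.I_im, mul_zero, Complex.ofReal_im, zero_mul,
    sub_zero, Real.exp_zero]

/-- `e_n` is continuous. [folklore] -/
theorem continuous_cellWaveN (L : ℝ) (n : Fin N × Fin 3 → ℤ) : Continuous (cellWaveN (N := N) L n) := by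
  have h : Continuous (toUnitTorusN (N := N) L) := by
    refine continuous_pi fun p => ?_
    have h1 : Continuous fun X : Config N => (X p.1) p.2 / L :=
      ((PiLp.continuous_apply 2 (fun _ : Fin 3 => ℝ) p.2).comp (continuous_apply p.1)).div_const L
    exact (AddCircle.continuous_mk' (1 : ℝ)).comp h1
  exact (mFourier n).continuous.comp h

/-- The plane waves are `Lℤ³`-periodic in every particle (`L ≠ 0`). [folklore] -/
theorem cellWaveN_periodic (hL : L ≠ 0) (n : Fin N × Fin 3 → ℤ) : IsTorusPeriodic L (cellWaveN (N := N) L n) := by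
  intro X i k
  unfold cellWaveN
  congr 1
  funext p
  rw [toUnitTorusN_apply, toUnitTorusN_apply, Pi.add_apply, PiLp.add_apply, add_div]
  push_cast
  rcases eq_or_ne p.1 i with h1 | h1
  · rw [h1, Pi.single_eq_same, PiLp.single_apply]
    split_ifs with h2
    · rw [div_self hL, AddCircle.coe_add]
      have : ((1 : ℝ) : UnitAddCircle) = 0 := by
        rw [AddCircle.coe_eq_zero_iff]; exact ⟨1, by simp⟩
      rw [this, add_zero]
    · simp
  · rw [Pi.single_eq_of_ne h1]
    simp

/-- **The Fourier coefficients as cell integrals**: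
`ĉₙ(Ψ) = L^{-3N} ∫_{[0,L)^{3N}} conj(e_n(X)) Ψ(X) dX`. [folklore] -/
theorem configFourierCoeff_eq_integral (hL : 0 < L) {Ψ : Config N → ℂ}
    (hΨ : AEStronglyMeasurable Ψ (volume.restrict (cellN N L))) (n : Fin N × Fin 3 → ℤ) :
    configFourierCoeff L Ψ n =
      ((((L ^ 3)⁻¹) ^ N : ℝ)) • ∫ X in cellN N L, conj (cellWaveN L n X) * Ψ X := by
  unfold configFourierCoeff mFourierCoeff torusFunN
  have hpt : ∀ t, mFourier (-n) t • Ψ (fromUnitTorusN L t) =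
      (fun X => conj (cellWaveN L n X) * Ψ X) (fromUnitTorusN L t) := fun t => by
    simp only [cellWaveN, toUnitTorusN_fromUnitTorusN hL.ne', mFourier_neg, smul_eq_mul]
  simp_rw [hpt]
  exact integral_fromUnitTorusN hL
    (((continuous_cellWaveN L n).aestronglyMeasurable.star).mul hΨ)

end CellIntegral

end Literature.MathematicalPhysics.QuantumManyBody.BoseGas
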